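/- Copyright: the b2b-balaban cell (near-miss cell 7), T⁴-continuum fan-out, lineage t4-ne7b-formalise-leaf-02 (NE7b
CRUX team (2), leaf prover 02; gen 107 sketch a5ac9cfa227d98de, gen 108 re-base) — (α)-instance, (A3) module J1
(tower instance): the reading slots of M2-B's `HistRead` INHABITED for the tower of IR-97-2; INTERFACE REQUEST NE7b
IR-99-1 of the row OWNER `t4-ne7b-p1` (pre-announced by ruling W-ne7bp1-g99-1, journal l.46956: «J1 v2 §§3–5 re-based
on part 2 v1.3's `reprFam`»; the normalised instance of the sketch's §1∕§2 was folded into IR-97-2 part 2 by the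
owner).  Released under the licence of the surrounding project. -/
import Mathlib.Data.Fin.Tuple.Take
import Summits.QuantumFields.BalabanUV.T4Continuum.Support.B16HistoryReprInstance
import Summits.QuantumFields.BalabanUV.T4Continuum.Support.B16HistoryInputFamilySanity

/-!
# (α)-INSTANCE, (A3) module J1 (tower instance): M2-B's `HistRead` INHABITED for the tower of IR-97-2, from per-step
envelopes and the per-history factorisation display — INTERFACE REQUEST NE7b IR-99-1

Summits-side support leaf of the T⁴-continuum cell (rung (B)+1 on a FINITE torus only; NOT infinite volume, NOT the
mass gap, NOT Clay; NOT a proof of NE7b — the cell's OWN estimate, NOT PRINTED, NOT PROVED).  [folklore] finite-sum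
algebra over IR-97-2 part 1 (`B16HistoryReprChain`: `Tower`, `adm`, `wAlong`, `abs_eterm_le`), part 2
(`B16HistoryReprInstance`: `hsmall`, `skel`, `skelFam`, `reprOf`, `reprFam`, `TZh_true_one_le`, `TC_false_one_le`),
M1 (`Repr172R`), M2-B (`B16HistoryInputFamily`: `HistReading`, `HistFactors`, `levelFactor`, `HistRead`,
`weight_le_evProd`) and its sanity companion (`RunInputM.comp_histM_eq_empty_of_N`); nothing printed is asserted,
no `def … : Prop` fact of Bałaban's, no cite-tagged hypothesis, zero `sorry`.  [Balaban1989LargeFieldII] (1.72)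
p. 379, (1.79) p. 383 and p. 384 l. 4–6 are quoted as LOCATORS only.  (§1∕§2 here = §3∕§4 of the gen-107 sketch,
whose §1∕§2 — the normalisation `A′ := log B`, `TZh true h := mulR (B⁻¹·eterm h)` — ARE part 2's `reprOf`∕`reprFam`
since v1.3, so the envelopes below are B-FREE and `B` rides in the record's `BA` slot; the sketch's §5, the junction
with M2-B's `weight_le_evProd` BY NAME, is the companion `B16HistoryReprReadJunction` for the 400-line lint.)

WHAT.  M2-B's `HistRead ℛ Φf R l₀ K₀` displays, for operations `R K t` over a skeleton family, the unit-weight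
envelopes `tz_le`∕`ty_le`∕`tc_le`, the envelopes `A'_le`∕`Vs_le`, and THE IDENTIFICATION `forest_le`: `wZ · wY ≤
∏_{j ≤ K} ∏_{c ∈ comp j} levelFactor` along the process run on the input read off the choice.  Here `R := reprFam`
(part 2: the tower's history terms, normalised) and: §1 (generic algebra) the product of per-step envelopes along a
history IN CLOSED FORM (`wAlong_eq_prod`, prefixes = Mathlib's `Fin.take`), its comparison with per-step targets
(`wAlong_le_prod_range`), THE TWO-LEVEL STENCIL (`prod_stencil_le`: per-step (level `j`) × (level `j+1`) products
against per-level products when the last level bears nothing and the first renews nothing) and the split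
`levelFactor = bfac · rfacs` (`prod_stencil_le_prod_levelFactor`, under `WF` and «no region born at the last
level»); §2 THE READING SLOTS: for ANY reading `ℛ : HistReading (skelFam T p₀) d` and factor values
`fB fR Λ`, the envelopes **`factorsOf`** (`wZ true h := wAlong (w K) K h`, `wY := 1`, `wC false := wAlong … hsmall`,
`BA := log B`, `BV := 0`) and **`histRead_tower`**: `HistRead ℛ (factorsOf …) (reprFam …) l₀ K₀` PROVED from (i)
per-step unit-weight envelopes `op_j(g,p) 1 ≤ w K j g p` (the per-operation factors (1.79) p. 383 attaches to ONE step
— (A1c)'s to instantiate), (ii) `|ρ₀ K t| ≤ B K t`, (iii) THE PER-HISTORY FACTORISATION DISPLAY `hfacZ`: `wAlong (w K)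
K h ≤ ∏_{j ≤ K} ∏_{c ∈ comp j (histM (runOf K true (h,(),())))} levelFactor` for the admissible `h ≠ hsmall`, and
`hfac0`: `1 ≤` the same product for the all-small history's run — p. 384 l. 4–6 «the product of factors coming from
the successive renormalization steps … can be factorized in components of Z_j» read onto the process, the ONE display
left of R2 for a tower-form run; **`histRead_tower_final`**: `hfac0` DISCHARGED when the reading gives the all-small
history no region (`hN0`); **`histRead_tower_stencil`**: (iii) REPLACED by the PER-STEP STENCIL display `hsten` — the
step-`j` envelope after `h|_j` is at most (birth-and-volume parts of the level-`j` components of the process read off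
`h`) × (renewal parts of its level-`(j+1)` components) — given `NewOK` and «no region born at the last level»; and,
for the other convention (a step's regions booked one level up, none at level `0`), **`histRead_tower_shifted`**.

NOT HERE (honest).  Which tower is Bałaban's ((A1c)); the reading `ℛ` itself (which regions ∕ classes ∕ cubes a
choice names); the per-step identification of `w K j g p` with the level factors of the components born ∕ renewed at
that step (the CONTENT of `hfacZ` ∕ `hsten` ∕ `hshift` — (A3) proper); the regions `Dom`∕`adm X` of part 3's tie;
M5; any estimate.  BY-NAME EFFECT ON THE WALL (`WALL-NE7b-P1.md` §2): NONE — `hR` becomes a theorem for a tower-form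
run GIVEN (i)–(iii), which are displays of the same R-class one level finer (per step).  HONEST DEPENDENCY (cell):
continuum YM on T⁴ ⇐ BetaPertH ∧ nine spine estimates (0/9 proved); BetaPertH ⇐ (D1) ∧ (D4) ∧ CAP+tail; G-an2-4
gates asym, D1 and NE2/3/4.  This file changes none of it.
-/

open Finset MeasureTheory
open Literature.MathematicalPhysics.QuantumFieldTheory.Balaban1983to89
open Summit.QuantumFields.BalabanUV.T4Continuum.HistoryAdmissible
open Summit.QuantumFields.BalabanUV.T4Continuum.HistoryGen
open Summit.QuantumFields.BalabanUV.T4Continuum.HistoryGenealogyExtraction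
open Summit.QuantumFields.BalabanUV.T4Continuum.HistoryGenealogyRealise
open Summit.QuantumFields.BalabanUV.T4Continuum.HistoryGenealogyInstantiate
open Summit.QuantumFields.BalabanUV.T4Continuum.HistoryGenealogyPedigree
open Summit.QuantumFields.BalabanUV.T4Continuum.HistoryRealiseWeakCells
open Summit.QuantumFields.BalabanUV.T4Continuum.HistoryTouchComponents

namespace Summit.QuantumFields.BalabanUV.T4Continuum.B16HistoryReprRead

open Summit.QuantumFields.BalabanUV.T4Continuum.B16HistoryIndexedRepr
open Summit.QuantumFields.BalabanUV.T4Continuum.B16HistoryReprChain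
open Summit.QuantumFields.BalabanUV.T4Continuum.B16HistoryReprInstance

noncomputable section

/-! ## §1 The product of per-step envelopes along a history, IN CLOSED FORM, and its comparison with per-level
targets (generic algebra; the step ↦ level stencil is (A3)'s — see the docstring of `wAlong_le_prod_range`) -/

section Steps

variable {P : Type}

/-- **THE PRODUCT ALONG A HISTORY IN CLOSED FORM**: `wAlong w K h = ∏_{j < K} w j (h|_j) (h j)`, the prefix `h|_j`
being Mathlib's `Fin.take j _ h`. [folklore] -/
theorem wAlong_eq_prod (w : (j : ℕ) → (Fin j → P) → P → ℝ) :
    ∀ (K : ℕ) (h : Fin K → P), Tower.wAlong w K h = ∏ j : Fin K, w j (Fin.take j j.2.le h) (h j)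
  | 0, _ => by
      show (1 : ℝ) = _
      simp
  | K + 1, h => by
      show Tower.wAlong w K (Fin.init h) * w K (Fin.init h) (h (Fin.last K)) = _
      rw [Fin.prod_univ_castSucc, wAlong_eq_prod w K (Fin.init h)]
      rfl

/-- **PER-STEP BOUNDS AGAINST PER-STEP TARGETS GIVE THE PRODUCT BOUND**: `w j (h|_j) (h j) ≤ G j` for every `j < K`,
`w ≥ 0` ⟹ `wAlong w K h ≤ ∏_{j ∈ range K} G j`.  For the reading, `G j` is whatever product of level factors the (A3)
stencil assigns to step `j` — NOT fixed here: a step's envelope splits across `levelFactor j` (births, volume of the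
new regions) and `levelFactor (j+1)` (renewal factors of the parts the level-`j` 𝐑-operation renews: `rfacs` reads
`rnw ((j+1) − 1)`), so step ↦ level is a two-level stencil, and §2 keeps the per-history product `hfacZ` as THE
interface. [folklore] -/
theorem wAlong_le_prod_range (w : (j : ℕ) → (Fin j → P) → P → ℝ) (hw0 : ∀ j g p, 0 ≤ w j g p) (K : ℕ)
    (h : Fin K → P) (G : ℕ → ℝ) (hs : ∀ j : Fin K, w j (Fin.take j j.2.le h) (h j) ≤ G j) :
    Tower.wAlong w K h ≤ ∏ j ∈ Finset.range K, G j := by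
  rw [wAlong_eq_prod, ← Fin.prod_univ_eq_prod_range]
  exact Finset.prod_le_prod (fun j _ => hw0 _ _ _) fun j _ => hs j

/-- **THE TWO-LEVEL STENCIL**: per-step products `X j · Y (j+1)` over the `K` steps are at most the per-level products
`X j · Y j` over the `K + 1` levels when the LAST level bears nothing (`1 ≤ X K`) and the FIRST level renews nothing
(`1 ≤ Y 0`) — the bookkeeping by which a step's (births·volume at its level) × (renewals booked one level up) is
compared with `∏_{j ≤ K} ∏_{c ∈ comp j} levelFactor`. [folklore] -/
theorem prod_stencil_le (K : ℕ) (X Y : ℕ → ℝ) (hX : ∀ j, 0 ≤ X j) (hY : ∀ j, 0 ≤ Y j) (hXK : 1 ≤ X K)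
    (hY0 : 1 ≤ Y 0) :
    ∏ j ∈ Finset.range K, (X j * Y (j + 1)) ≤ ∏ j ∈ Finset.range (K + 1), (X j * Y j) := by
  rw [Finset.prod_mul_distrib, Finset.prod_mul_distrib, Finset.prod_range_succ X, Finset.prod_range_succ' Y]
  have hPX : 0 ≤ ∏ j ∈ Finset.range K, X j := Finset.prod_nonneg fun j _ => hX j
  have hPY : 0 ≤ ∏ j ∈ Finset.range K, Y (j + 1) := Finset.prod_nonneg fun j _ => hY (j + 1)
  calc (∏ j ∈ Finset.range K, X j) * ∏ j ∈ Finset.range K, Y (j + 1)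
      = ((∏ j ∈ Finset.range K, X j) * 1) * ((∏ j ∈ Finset.range K, Y (j + 1)) * 1) := by ring
    _ ≤ ((∏ j ∈ Finset.range K, X j) * X K) * ((∏ j ∈ Finset.range K, Y (j + 1)) * Y 0) :=
        mul_le_mul (mul_le_mul_of_nonneg_left hXK hPX) (mul_le_mul_of_nonneg_left hY0 hPY)
          (mul_nonneg hPY zero_le_one) (mul_nonneg hPX (hX K))

section LevelFactorSplit

variable {DomK : ℕ → Type} {I : (K : ℕ) → HIndex (DomK K)} {d : ℕ} (Φf : HistFactors I d)

/-- THE BIRTH-AND-VOLUME PART of a level factor: `Λ K j ^ #(domain)` times the birth factors of the component's new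
regions (what a step books AT ITS OWN level). [folklore] -/
def bfac (H : ComponentHistory (Lab d)) (K j : ℕ) (c : Lab d) : ℝ :=
  Φf.Λ K j ^ (c.2).card * ((H.news j c).map fun n => Φf.fB K j (H.cls n) n).prod

/-- a level factor is its birth-and-volume part times the renewal factors of its renewed parts (booked one level up
by the step that renews them: `rfacs` reads `rnw (j − 1)`). [folklore] -/
theorem levelFactor_eq_bfac_mul_rfacs (H : ComponentHistory (Lab d)) (rnw : ℕ → Lab d → Bool) (K j : ℕ) (c : Lab d) :
    Φf.levelFactor H rnw K j c = bfac Φf H K j c * H.rfacs rnw (Φf.fR K) j c := by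
  unfold HistFactors.levelFactor bfac
  ring

/-- the birth-and-volume part is non-negative [folklore] -/
theorem bfac_nonneg (hfB : ∀ K j d' n, 0 ≤ Φf.fB K j d' n) (H : ComponentHistory (Lab d)) (K j : ℕ) (c : Lab d) :
    0 ≤ bfac Φf H K j c := by
  unfold bfac
  refine mul_nonneg (pow_nonneg (zero_le_one.trans (Φf.one_le_Λ K j)) _) (List.prod_nonneg fun x hx => ?_)
  obtain ⟨n, -, rfl⟩ := List.mem_map.mp hx
  exact hfB K j _ n

/-- the renewal part is non-negative [folklore] -/
theorem rfacs_nonneg (hfR : ∀ K h, 0 ≤ Φf.fR K h) (H : ComponentHistory (Lab d)) (rnw : ℕ → Lab d → Bool) (K j : ℕ)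
    (c : Lab d) : 0 ≤ H.rfacs rnw (Φf.fR K) j c := by
  unfold ComponentHistory.rfacs
  refine List.prod_nonneg fun x hx => ?_
  obtain ⟨p, -, rfl⟩ := List.mem_map.mp hx
  split_ifs
  · exact hfR K _
  · exact zero_le_one

/-- a component WITHOUT new regions has birth-and-volume part `≥ 1` (`Λ ≥ 1`) [folklore] -/
theorem one_le_bfac_of_news_nil (H : ComponentHistory (Lab d)) (K j : ℕ) (c : Lab d) (h : H.news j c = []) :
    1 ≤ bfac Φf H K j c := by
  unfold bfac
  rw [h, List.map_nil, List.prod_nil, mul_one]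
  exact Φf.one_le_Λ_pow K j _

/-- at level `0` nothing is renewed (`WF.parts_zero`) [folklore] -/
theorem rfacs_zero_eq_one (H : ComponentHistory (Lab d)) (hW : H.WF) (rnw : ℕ → Lab d → Bool) (K : ℕ) (c : Lab d) :
    H.rfacs rnw (Φf.fR K) 0 c = 1 := by
  simp [ComponentHistory.rfacs, hW.parts_zero c]

/-- **THE STENCIL AGAINST THE LEVEL FACTORS**: for a well-formed component history whose LAST level `K` bears no new
region, the per-step products (birth-and-volume part of the level-`j` components) × (renewal part of the level-`(j+1)`
components), `j < K`, are at most `∏_{j ≤ K} ∏_{c ∈ comp j} levelFactor`. [folklore] -/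
theorem prod_stencil_le_prod_levelFactor (hfB : ∀ K j d' n, 0 ≤ Φf.fB K j d' n) (hfR : ∀ K h, 0 ≤ Φf.fR K h)
    (H : ComponentHistory (Lab d)) (hW : H.WF) (rnw : ℕ → Lab d → Bool) (K : ℕ)
    (hnewsK : ∀ c ∈ H.comp K, H.news K c = []) :
    ∏ j ∈ Finset.range K, ((∏ c ∈ H.comp j, bfac Φf H K j c) * ∏ c ∈ H.comp (j + 1), H.rfacs rnw (Φf.fR K) (j + 1) c) ≤
      ∏ j ∈ Finset.range (K + 1), ∏ c ∈ H.comp j, Φf.levelFactor H rnw K j c := by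
  have e : ∀ j, ∏ c ∈ H.comp j, Φf.levelFactor H rnw K j c =
      (∏ c ∈ H.comp j, bfac Φf H K j c) * ∏ c ∈ H.comp j, H.rfacs rnw (Φf.fR K) j c := fun j => by
    rw [← Finset.prod_mul_distrib]
    exact Finset.prod_congr rfl fun c _ => levelFactor_eq_bfac_mul_rfacs Φf H rnw K j c
  simp only [e]
  refine prod_stencil_le K (fun j => ∏ c ∈ H.comp j, bfac Φf H K j c)
    (fun j => ∏ c ∈ H.comp j, H.rfacs rnw (Φf.fR K) j c)
    (fun j => Finset.prod_nonneg fun c _ => bfac_nonneg Φf hfB H K j c)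
    (fun j => Finset.prod_nonneg fun c _ => rfacs_nonneg Φf hfR H rnw K j c) ?_ ?_
  · calc (1 : ℝ) = ∏ _c ∈ H.comp K, (1 : ℝ) := Finset.prod_const_one.symm
      _ ≤ ∏ c ∈ H.comp K, bfac Φf H K K c :=
          Finset.prod_le_prod (fun _ _ => zero_le_one) fun c hc => one_le_bfac_of_news_nil Φf H K K c (hnewsK c hc)
  · rw [Finset.prod_congr rfl fun c _ => rfacs_zero_eq_one Φf H hW rnw K c, Finset.prod_const_one]

end LevelFactorSplit

end Steps

/-! ## §2 THE READING SLOTS: `HistRead` INHABITED for the tower instance from per-step envelopes and the per-history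
factorisation display -/

section Read

variable {P : Type} [DecidableEq P] {C : ℕ → ℕ → Type} {𝒢 : (K j : ℕ) → GoodClass (C K j)}
  (T : (K : ℕ) → Tower P (C K) (𝒢 K)) (p₀ : ℕ → ℕ → P)
  (ρ₀ : (K : ℕ) → ℝ → C K 0 → ℝ) (hρ : ∀ K t, (𝒢 K 0).Gd (ρ₀ K t)) (h0 : ∀ K t x, 0 ≤ ρ₀ K t x)
  (B : ℕ → ℝ → ℝ) (hB : ∀ K t, 0 < B K t)
  {d : ℕ} (fB : ℕ → ℕ → ℕ → Lab d → ℝ) (fR : ℕ → ℕ → ℝ) (Λ : ℕ → ℕ → ℝ) (hΛ : ∀ K j, 1 ≤ Λ K j)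
  (w : (K : ℕ) → (j : ℕ) → (Fin j → P) → P → ℝ)

/-- **THE ENVELOPES OF THE TOWER INSTANCE** (M2-B's `HistFactors` over `skelFam`): factor values `fB`, `fR`, `Λ` as
given (balaban-calc's ∕ M5's by value); `wZ K t true h := wAlong (w K) K h` (the product of the per-step envelopes
along the history — B-FREE), `wZ K t false _ := 1`; `wY := 1`; `wC K t true _ := 1`, `wC K t false _ := wAlong (w K) K
hsmall` (the all-small history term is a normalisation); `BA K t := log (B K t)` (the sup of the dressed initial
density — the record's `hBA ≤ BAi` slot); `BV := 0`. [folklore] -/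
def factorsOf : HistFactors (skelFam T p₀) d where
  fB := fB
  fR := fR
  Λ := Λ
  one_le_Λ := hΛ
  wZ K _ a h := if a then Tower.wAlong (w K) K h else 1
  wY _ _ _ _ := 1
  wC K _ a _ := if a then 1 else Tower.wAlong (w K) K (hsmall (p₀ K) K)
  BA K t := Real.log (B K t)
  BV _ _ _ _ _ _ := 0

variable (ℛ : HistReading (skelFam T p₀) d)

/-- **`HistRead` INHABITED FOR THE TOWER INSTANCE** from (i) per-step unit-weight envelopes (`hw0`, `hw`), (ii) the sup
of the dressed initial density (`hBρ`), (iii) THE PER-HISTORY FACTORISATION DISPLAY: `hfacZ` for the admissible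
`h ≠ hsmall` (the large summand's histories) and `hfac0` for the all-small history's run.  Every other clause of
`HistRead` (`χ01`, `tz_le`, `ty_le`, `tc_le`, `A'_le`, `Vs_le`) is PROVED. [folklore] -/
theorem histRead_tower {l₀ : ℝ} {K₀ : ℕ} (hw0 : ∀ K j g p, 0 ≤ w K j g p)
    (hw : ∀ K, K₀ ≤ K → ∀ j g p x, ((T K).op j g p).T (fun _ => 1) x ≤ w K j g p)
    (hBρ : ∀ K t, |t| ≤ l₀ → K₀ ≤ K → ∀ y, |ρ₀ K t y| ≤ B K t)
    (hfacZ : ∀ K t, |t| ≤ l₀ → K₀ ≤ K → ∀ h ∈ ((T K).adm K).erase (hsmall (p₀ K) K),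
      Tower.wAlong (w K) K h ≤ ∏ j ∈ Finset.range (K + 1), ∏ c ∈ (ℛ.runOf K true (h, (), ())).histM.comp j,
        (factorsOf T p₀ B fB fR Λ hΛ w).levelFactor (ℛ.runOf K true (h, (), ())).histM
          (ℛ.runOf K true (h, (), ())).rnwM K j c)
    (hfac0 : ∀ K t, |t| ≤ l₀ → K₀ ≤ K →
      1 ≤ ∏ j ∈ Finset.range (K + 1), ∏ c ∈ (ℛ.runOf K false (hsmall (p₀ K) K, (), ())).histM.comp j,
        (factorsOf T p₀ B fB fR Λ hΛ w).levelFactor (ℛ.runOf K false (hsmall (p₀ K) K, (), ())).histM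
          (ℛ.runOf K false (hsmall (p₀ K) K, (), ())).rnwM K j c) :
    HistRead ℛ (factorsOf T p₀ B fB fR Λ hΛ w) (reprFam T p₀ ρ₀ hρ h0 B hB) l₀ K₀ where
  χ01 _ _ _ _ := ⟨zero_le_one, le_rfl⟩
  tz_le K t ht hK a h hh W := by
    cases a with
    | false =>
        show (1 : ℝ) ≤ 1
        exact le_rfl
    | true =>
        show ((reprOf (T K) (p₀ K) K (hρ K t) (h0 K t) (hB K t)).TZh true h).T (fun _ => 1) W ≤ Tower.wAlong (w K) K h
        exact TZh_true_one_le (T K) (p₀ K) K (hρ K t) (h0 K t) (hB K t) (w K) (hw0 K) (hw K hK) (hBρ K t ht hK) h W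
  ty_le _ _ _ _ _ _ _ _ := by
    show (1 : ℝ) ≤ 1
    exact le_rfl
  tc_le K t ht hK a c hc W := by
    cases a with
    | true =>
        show (1 : ℝ) ≤ 1
        exact le_rfl
    | false =>
        cases c
        show ((reprOf (T K) (p₀ K) K (hρ K t) (h0 K t) (hB K t)).TC false ()).T (fun _ => 1) W ≤
          Tower.wAlong (w K) K (hsmall (p₀ K) K)
        exact TC_false_one_le (T K) (p₀ K) K (hρ K t) (h0 K t) (hB K t) (w K) (hw0 K) (hw K hK) (hBρ K t ht hK) W
  A'_le _ _ _ _ _ := le_rfl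
  Vs_le _ _ _ _ _ _ _ _ _ := le_rfl
  forest_le K t ht hK a ι hι := by
    obtain ⟨h, l, c⟩ := ι
    cases l; cases c
    cases a with
    | true =>
        have hh : h ∈ ((T K).adm K).erase (hsmall (p₀ K) K) := by
          simpa [HIndex.LIdx, Finset.mem_product] using hι
        show Tower.wAlong (w K) K h * 1 ≤ _
        rw [mul_one]
        exact hfacZ K t ht hK h hh
    | false =>
        have hh : h = hsmall (p₀ K) K := by
          simpa [HIndex.LIdx, Finset.mem_product] using hι
        subst hh
        show (1 : ℝ) * 1 ≤ _
        rw [mul_one]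
        exact hfac0 K t ht hK

/-! ### The all-small history's run: reading NO region, it has no component (leaf-04's
`RunInputM.comp_histM_eq_empty_of_N`), so its level-factor product is `1` and `hfac0` is discharged -/

/-- **THE ALL-SMALL RUN's LEVEL-FACTOR PRODUCT IS `1`** when the reading gives the all-small history no new region
(`hN0` — the natural clause: no large field, no large-field region). [folklore] -/
theorem prod_levelFactor_allSmall (Φf : HistFactors (skelFam T p₀) d) (K : ℕ)
    (hN0 : ∀ ℓ, ℛ.N K false (hsmall (p₀ K) K, (), ()) ℓ = ∅) :
    ∏ j ∈ Finset.range (K + 1), ∏ c ∈ (ℛ.runOf K false (hsmall (p₀ K) K, (), ())).histM.comp j,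
      Φf.levelFactor (ℛ.runOf K false (hsmall (p₀ K) K, (), ())).histM
        (ℛ.runOf K false (hsmall (p₀ K) K, (), ())).rnwM K j c = 1 := by
  refine Finset.prod_eq_one fun j _ => ?_
  rw [(ℛ.runOf K false (hsmall (p₀ K) K, (), ())).comp_histM_eq_empty_of_N (fun ℓ => hN0 ℓ) j, Finset.prod_empty]

/-- **`HistRead` FOR THE TOWER INSTANCE — FINAL FORM OF THIS SKETCH**: from (i) per-step unit-weight envelopes, (ii) the
sup of the dressed initial density, (iii) the per-history factorisation display `hfacZ` for the large summand's
histories, (iv) the all-small history names no region (`hN0`).  What (A3) proper still owes is the CONTENT of `hfacZ`: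
which regions ∕ classes ∕ cubes a choice names (`ℛ`), and that the product of a history's step envelopes is at most the
level-by-level product of the level factors of the components of the process so read — p. 384 l. 4–6 —, e.g. by
§1's `wAlong_le_prod_range` once the step ↦ level stencil is fixed. [folklore] -/
theorem histRead_tower_final {l₀ : ℝ} {K₀ : ℕ} (hw0 : ∀ K j g p, 0 ≤ w K j g p)
    (hw : ∀ K, K₀ ≤ K → ∀ j g p x, ((T K).op j g p).T (fun _ => 1) x ≤ w K j g p)
    (hBρ : ∀ K t, |t| ≤ l₀ → K₀ ≤ K → ∀ y, |ρ₀ K t y| ≤ B K t)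
    (hfacZ : ∀ K t, |t| ≤ l₀ → K₀ ≤ K → ∀ h ∈ ((T K).adm K).erase (hsmall (p₀ K) K),
      Tower.wAlong (w K) K h ≤ ∏ j ∈ Finset.range (K + 1), ∏ c ∈ (ℛ.runOf K true (h, (), ())).histM.comp j,
        (factorsOf T p₀ B fB fR Λ hΛ w).levelFactor (ℛ.runOf K true (h, (), ())).histM
          (ℛ.runOf K true (h, (), ())).rnwM K j c)
    (hN0 : ∀ K, K₀ ≤ K → ∀ ℓ, ℛ.N K false (hsmall (p₀ K) K, (), ()) ℓ = ∅) :
    HistRead ℛ (factorsOf T p₀ B fB fR Λ hΛ w) (reprFam T p₀ ρ₀ hρ h0 B hB) l₀ K₀ :=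
  histRead_tower T p₀ ρ₀ hρ h0 B hB fB fR Λ hΛ w ℛ hw0 hw hBρ hfacZ
    (fun K _ _ hK => (prod_levelFactor_allSmall T p₀ ℛ (factorsOf T p₀ B fB fR Λ hΛ w) K (hN0 K hK)).symm.le)

/-! ### The per-history display from the PER-STEP STENCIL (births·volume at the step's level × renewals one level up) -/

/-- **`HistRead` FOR THE TOWER INSTANCE FROM PER-STEP DISPLAYS** (the finest form of this sketch): (i) per-step
unit-weight envelopes `hw`; (ii) `hBρ`; (iii″) THE PER-STEP STENCIL `hsten`: after the admissible history `h`, the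
step-`j` envelope `w K j (h|_j) (h j)` is at most (the birth-and-volume parts `bfac` of the level-`j` components of the
process read off `h`) × (the renewal parts `rfacs` of its level-`(j+1)` components) — p. 384 l. 4–6 per step, R-class,
(A3)'s to read —; (iv) the all-small history names no region (`hN0`); (v) no region is born at the last level
(`hNK`: the cutoff-`K` tower has `K` choices) and the END's `NewOK` binder for the runs read off the large summand's
histories (`hNOK`, for `wf_histM`); non-negative factor values. [folklore] -/
theorem histRead_tower_stencil {l₀ : ℝ} {K₀ : ℕ} (hw0 : ∀ K j g p, 0 ≤ w K j g p)
    (hw : ∀ K, K₀ ≤ K → ∀ j g p x, ((T K).op j g p).T (fun _ => 1) x ≤ w K j g p)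
    (hBρ : ∀ K t, |t| ≤ l₀ → K₀ ≤ K → ∀ y, |ρ₀ K t y| ≤ B K t)
    (hfB : ∀ K j d' n, 0 ≤ fB K j d' n) (hfR : ∀ K h, 0 ≤ fR K h)
    (hNOK : ∀ K, K₀ ≤ K → ∀ h ∈ ((T K).adm K).erase (hsmall (p₀ K) K), (ℛ.runOf K true (h, (), ())).NewOK)
    (hNK : ∀ K, K₀ ≤ K → ∀ h ∈ ((T K).adm K).erase (hsmall (p₀ K) K), ℛ.N K true (h, (), ()) K = ∅)
    (hsten : ∀ K t, |t| ≤ l₀ → K₀ ≤ K → ∀ h ∈ ((T K).adm K).erase (hsmall (p₀ K) K), ∀ j : Fin K,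
      w K j (Fin.take j j.2.le h) (h j) ≤
        (∏ c ∈ (ℛ.runOf K true (h, (), ())).histM.comp j,
            bfac (factorsOf T p₀ B fB fR Λ hΛ w) (ℛ.runOf K true (h, (), ())).histM K j c) *
          ∏ c ∈ (ℛ.runOf K true (h, (), ())).histM.comp (j + 1),
            (ℛ.runOf K true (h, (), ())).histM.rfacs (ℛ.runOf K true (h, (), ())).rnwM
              ((factorsOf T p₀ B fB fR Λ hΛ w).fR K) (j + 1) c)
    (hN0 : ∀ K, K₀ ≤ K → ∀ ℓ, ℛ.N K false (hsmall (p₀ K) K, (), ()) ℓ = ∅) :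
    HistRead ℛ (factorsOf T p₀ B fB fR Λ hΛ w) (reprFam T p₀ ρ₀ hρ h0 B hB) l₀ K₀ := by
  refine histRead_tower_final T p₀ ρ₀ hρ h0 B hB fB fR Λ hΛ w ℛ hw0 hw hBρ (fun K t ht hK h hh => ?_) hN0
  set J := ℛ.runOf K true (h, (), ()) with hJ
  have hW : J.histM.WF := J.wf_histM (hNOK K hK h hh)
  have hnewsK : ∀ c ∈ J.histM.comp K, J.histM.news K c = [] := fun c hc =>
    List.eq_nil_iff_forall_not_mem.mpr fun n hn => by
      have hmem : n ∈ ℛ.N K true (h, (), ()) K := hW.news_sub K c hc n hn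
      rw [hNK K hK h hh] at hmem
      exact Finset.notMem_empty n hmem
  exact (wAlong_le_prod_range (w K) (hw0 K) K h _ (hsten K t ht hK h hh)).trans
    (prod_stencil_le_prod_levelFactor (factorsOf T p₀ B fB fR Λ hΛ w) hfB hfR J.histM hW J.rnwM K hnewsK)

/-! ### The other convention: everything a step does is booked ONE LEVEL UP (no region at level `0`) -/

/-- a run with no new region AT LEVEL `0` has no level-`0` component [folklore] -/
theorem comp_histM_zero_eq_empty (J : RunInputM d) (hN : J.N 0 = ∅) : J.histM.comp 0 = ∅ := by
  show (J.StM 0).image lab = ∅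
  rw [J.StM_eq_formM]
  simp [RunInputM.formM, RunInputM.blocksM, RunInputM.vertM, RunInputM.PrevM, tcomps, hN]

/-- **`HistRead` FOR THE TOWER INSTANCE, SHIFTED CONVENTION**: if the reading books a step's regions one level up
(nothing at level `0`: `hN00`), the per-step display is simply `w K j (h|_j) (h j) ≤ ∏_{c ∈ comp (j+1)} levelFactor (j+1)
c` (`hshift`); level `0` contributes `1`. [folklore] -/
theorem histRead_tower_shifted {l₀ : ℝ} {K₀ : ℕ} (hw0 : ∀ K j g p, 0 ≤ w K j g p)
    (hw : ∀ K, K₀ ≤ K → ∀ j g p x, ((T K).op j g p).T (fun _ => 1) x ≤ w K j g p)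
    (hBρ : ∀ K t, |t| ≤ l₀ → K₀ ≤ K → ∀ y, |ρ₀ K t y| ≤ B K t)
    (hN00 : ∀ K, K₀ ≤ K → ∀ h ∈ ((T K).adm K).erase (hsmall (p₀ K) K), ℛ.N K true (h, (), ()) 0 = ∅)
    (hshift : ∀ K t, |t| ≤ l₀ → K₀ ≤ K → ∀ h ∈ ((T K).adm K).erase (hsmall (p₀ K) K), ∀ j : Fin K,
      w K j (Fin.take j j.2.le h) (h j) ≤
        ∏ c ∈ (ℛ.runOf K true (h, (), ())).histM.comp (j + 1),
          (factorsOf T p₀ B fB fR Λ hΛ w).levelFactor (ℛ.runOf K true (h, (), ())).histM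
            (ℛ.runOf K true (h, (), ())).rnwM K (j + 1) c)
    (hN0 : ∀ K, K₀ ≤ K → ∀ ℓ, ℛ.N K false (hsmall (p₀ K) K, (), ()) ℓ = ∅) :
    HistRead ℛ (factorsOf T p₀ B fB fR Λ hΛ w) (reprFam T p₀ ρ₀ hρ h0 B hB) l₀ K₀ := by
  refine histRead_tower_final T p₀ ρ₀ hρ h0 B hB fB fR Λ hΛ w ℛ hw0 hw hBρ (fun K t ht hK h hh => ?_) hN0
  have hc0 : (ℛ.runOf K true (h, (), ())).histM.comp 0 = ∅ :=
    comp_histM_zero_eq_empty (ℛ.runOf K true (h, (), ())) (hN00 K hK h hh)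
  have e : (∏ j ∈ Finset.range (K + 1), ∏ c ∈ (ℛ.runOf K true (h, (), ())).histM.comp j,
        (factorsOf T p₀ B fB fR Λ hΛ w).levelFactor (ℛ.runOf K true (h, (), ())).histM
          (ℛ.runOf K true (h, (), ())).rnwM K j c) =
      ∏ j ∈ Finset.range K, ∏ c ∈ (ℛ.runOf K true (h, (), ())).histM.comp (j + 1),
        (factorsOf T p₀ B fB fR Λ hΛ w).levelFactor (ℛ.runOf K true (h, (), ())).histM
          (ℛ.runOf K true (h, (), ())).rnwM K (j + 1) c := by
    rw [Finset.prod_range_succ', hc0, Finset.prod_empty, mul_one]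
  rw [e]
  exact wAlong_le_prod_range (w K) (hw0 K) K h
    (fun j => ∏ c ∈ (ℛ.runOf K true (h, (), ())).histM.comp (j + 1),
      (factorsOf T p₀ B fB fR Λ hΛ w).levelFactor (ℛ.runOf K true (h, (), ())).histM
        (ℛ.runOf K true (h, (), ())).rnwM K (j + 1) c) (hshift K t ht hK h hh)

end Read

end

end Summit.QuantumFields.BalabanUV.T4Continuum.B16HistoryReprRead
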